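import Summits.HodgeConjecture.CorCM.IrreducibleOddWeightsCanonicalPivotCMFields
import Literature.NumberTheory.ComplexMultiplication.CMTypeRankTwoBlocks
import HarnessLib

/-!
# The defect as a count of HODGE WEIGHTS: `Σ_i dim Hg(A_i) − dim Hg(∏_i A_i)` is the number of independent
# Galois-balanced weights of the product that are not accounted for by the balanced weights of the factors

COR-CM (cell `pub-hodgecm2`, binder seat `b16` gen 65, count-neutral claim CANONICAL PIVOT + HODGE WEIGHTS, file C6 —
abstract `G`-set level and CM fields; theorems only, no definition, no named fact, no `sorry`).  NEW as stated, hence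
under `Summits/`.  HONEST FRAMING: finite-dimensional linear algebra (rank–nullity) putting the DEFECT of a family of CM
types in Pohlmann's dictionary «Hodge classes of a CM abelian variety ⟷ Galois-balanced weights»; no Hodge class is
claimed algebraic; `HC_CM` is neither used nor asserted.  It answers the honest-open item of gen 64's card «the defect
NUMBER has no Hodge-class dictionary (only `= 0` ⟺ product span)».

SETTING (tree `Literature/…/CMTypeRank`: `IsBalanced G Φ a` is POHLMANN'S CONDITION `2·Σ_x a(x)[g·x ∈ Φ] = Σ_x a(x)`
for all `g` on a rational weight `a : X → ℚ` — by Pohlmann's theorem (tree `Pohlmann1968_thm1_cmAlgebra`,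
`isNondegenerateFamily_iff_forall_nat_symm`) the `ℕ`-valued balanced weights on `⊔_i Hom(K_i, ℂ)` are exactly the
supports of the Hodge classes on the products of powers `∏_i A_i^{k_i}`; gen 64 R1 `IrreducibleOddWeightsRightIdeals`:
matrix-coefficient spaces `MC_i ≤ ℚ^G`, `Σ_i dim Hg(A_i) − dim Hg(∏_i A_i) = Σ_i dim MC_i − dim Σ_i MC_i`).  Write
`T_Φ : ℚ^X → ℚ^G`, `a ↦ (g ↦ Σ_x a(x)·u_g(x))` — the linear map of the TRANSLATE MATRIX `(g, x) ↦ u(g·x)` (Mathlib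
`Matrix.mulVecLin`); then

* §1 **`mem_ker_mulVecLin_antiVec_iff_isBalanced`** — `ker T_Φ = B(Φ)`, the BALANCED WEIGHTS (Pohlmann's condition is
  `⟨a, u_g⟩ = 0 ∀ g`); **`range_mulVecLin_antiVec_eq_span_coeff`** — `range T_Φ = MC(Φ)` (the columns of the translate
  matrix are the matrix coefficients); hence by rank–nullity **`finrank_ker_add_finrank_span_coeff_eq_card`**:
  `dim B(Φ) + dim MC(Φ) = |X|`, and **`finrank_ker_add_typeRank_eq_card_add_one`**: `dim B(Φ) + rank Φ = |X| + 1`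
  (`dim B(Φ) = |X| − dim Hg(A)`: the balanced weights are the characters of `T^X` trivial on the Hodge torus).
* §2 FAMILIES: **`finrank_ker_sigmaType_add_typeRank_add_card_eq`** —
  `dim B(Σ) + rank(Σ) + |I| = Σ_i dim B(Φ_i) + Σ_i rank Φ_i + 1`, i.e. **THE DICTIONARY
  `Σ_i dim Hg(A_i) − dim Hg(∏_i A_i) = dim B(Σ) − Σ_i dim B(Φ_i)`**: the defect is the number of independent balanced
  weights of the PRODUCT modulo those assembled blockwise from balanced weights of the FACTORS (which do lie in `B(Σ)`:
  `sigmaLift_mem_ker_of_forall_mem_ker`; their classes are the exterior products of Hodge classes of the factors, the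
  others support the MIXED exceptional classes of the tree's `…ProductSpanCMProductsSharp`); equivalently
  **`finrank_ker_sigmaType_add_finrank_iSup_eq`**: `dim B(Σ) + dim Σ_i MC_i = Σ_i dim B(Φ_i) + Σ_i dim MC_i`; pairs:
  **`finrank_ker_sigmaType_eq_add_add_finrank_inf_of_pair`** — `dim B(Φ₀, Φ₁) = dim B(Φ₀) + dim B(Φ₁) + dim(MC₀ ∩ MC₁)`
  `= dim B(Φ₀) + dim B(Φ₁) + dim(F₀^{PW₁} ∩ F₁^{PW₀})` (C1's canonical pivot).
* §3 CM fields (`G = Aut(ℂ)`, `X = Hom(K, ℂ)`): `finrank_ker_add_cmTypeRank_eq`, **`finrank_ker_familyType_add_cmFamilyRank_add_card_eq`**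
  — `dim B(Σ) + cmFamilyRank Φ + |I| = Σ_i dim B(Φ_i) + Σ_i cmTypeRank Φ_i + 1` for every finite family of CM fields and
  types: the codimension of `Hg(∏_i A_i)` in `∏_i Hg(A_i)` counts the independent Galois-balanced weights on
  `⊔_i Hom(K_i, ℂ)` beyond the blockwise-balanced ones.

## References

* [Pohlmann1968] H. Pohlmann, *Algebraic cycles on abelian varieties of complex multiplication type*, Ann. of Math. 88
  (1968), Thm. 1 (through [Gordon1999HodgeAVSurvey, §9.2] and [Milne2020HodgeClassesAV, 1.2]).
* [Gordon1999HodgeAVSurvey] B. B. Gordon, *A survey of the Hodge conjecture for abelian varieties*, §9.2 (9.2.1), §9.3,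
  7.5–7.7.
* [Deligne1982HodgeCycles] P. Deligne, *Hodge cycles on abelian varieties*, LNM 900 (1982), I.3.4, I.5 (p. 62), I Ex. 3.7.
* [Ribet1980] K. A. Ribet, *Division fields of abelian varieties with complex multiplication*, Mém. SMF 2 (1980), §3 (3.3).
-/

set_option autoImplicit false

noncomputable section

open scoped BigOperators Classical

universe u v w

namespace Summit.HodgeConjecture.CorCM.IrrOdd

open Literature.NumberTheory.ComplexMultiplication

variable {G : Type w} [Group G]

/-! ### §1 One type: balanced weights are the kernel, matrix coefficients the range, of the translate matrix -/

section One

variable {X : Type v} [MulAction G X] [Fintype X]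

/-- **`ker T_Φ = B(Φ)`**: a rational weight `a` on `X` lies in the kernel of the translate matrix `(g, x) ↦ u_g(x)` iff
it satisfies POHLMANN'S CONDITION `2·Σ_x a(x)[g·x ∈ Φ] = Σ_x a(x)` for every `g` (`⟨a, u_g⟩ = 0`).
[cite: Gordon1999HodgeAVSurvey, §9.2 (9.2.1)] -/
theorem mem_ker_mulVecLin_antiVec_iff_isBalanced (Φ : Set X) (a : X → ℚ) :
    a ∈ LinearMap.ker (Matrix.of fun (g : G) (x : X) => antiVec Φ g x).mulVecLin ↔ IsBalanced G Φ a := by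
  rw [isBalanced_iff_forall_dotProduct_antiVec, LinearMap.mem_ker, Matrix.mulVecLin_apply, funext_iff]
  refine forall_congr' fun g => ?_
  rw [Pi.zero_apply, Matrix.mulVec, dotProduct_comm]
  rfl

/-- **`range T_Φ = MC(Φ)`**: the columns of the translate matrix are the matrix coefficients `c_x(g) = u(g·x)`.
[cite: Ribet1980, §3 (3.3)] -/
theorem range_mulVecLin_antiVec_eq_span_coeff (Φ : Set X) :
    LinearMap.range (Matrix.of fun (g : G) (x : X) => antiVec Φ g x).mulVecLin =
      Submodule.span ℚ (Set.range fun x : X => fun g : G => antiVec Φ g x) := by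
  rw [Matrix.range_mulVecLin]
  rfl

/-- **`dim B(Φ) + dim MC(Φ) = |X|`** (rank–nullity for the translate matrix).
[cite: Gordon1999HodgeAVSurvey, §9.2–9.3] [cite: Ribet1980, §3 (3.3)] -/
theorem finrank_ker_add_finrank_span_coeff_eq_card (Φ : Set X) :
    Module.finrank ℚ (LinearMap.ker (Matrix.of fun (g : G) (x : X) => antiVec Φ g x).mulVecLin) +
        Module.finrank ℚ (Submodule.span ℚ (Set.range fun x : X => fun g : G => antiVec Φ g x)) =
      Fintype.card X := by
  rw [← range_mulVecLin_antiVec_eq_span_coeff, add_comm, LinearMap.finrank_range_add_finrank_ker,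
    Module.finrank_fintype_fun_eq_card]

/-- **`dim B(Φ) + rank Φ = |X| + 1`**, i.e. `dim B(Φ) = |X| − dim Hg(A)`: the balanced weights are the rational
characters of the torus `T^X` that are trivial on the Hodge torus (for a CM type `Φ`; `dim MC = dim U = rank − 1`).
[cite: Gordon1999HodgeAVSurvey, §9.2–9.3 and 7.5] [cite: Deligne1982HodgeCycles, I Ex. 3.7 (c)] -/
theorem finrank_ker_add_typeRank_eq_card_add_one [Nonempty X] {ρ : G} {Φ : Set X} (h : IsCMTypeWith ρ Φ) :
    Module.finrank ℚ (LinearMap.ker (Matrix.of fun (g : G) (x : X) => antiVec Φ g x).mulVecLin) + typeRank G Φ =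
      Fintype.card X + 1 := by
  rw [h.typeRank_eq_finrank_antiSpan_add_one, finrank_antiSpan_eq_finrank_span_coeff, ← add_assoc,
    finrank_ker_add_finrank_span_coeff_eq_card]

end One

/-! ### §2 Families: the defect counts the balanced weights of the product beyond the blockwise ones -/

section Family

variable {I : Type u} {E : I → Type v} [∀ i, MulAction G (E i)] [Fintype I] [∀ i, Fintype (E i)]

/-- **Blockwise-balanced weights are balanced for the product**: if every `a_i` is balanced for `Φ_i` then the weight
`(i, x) ↦ a_i(x)` on `⊔_i E_i` is balanced for `Σ` (its pairing with `u_g(Σ)` is the sum of the blockwise pairings) —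
these are the supports of the exterior products of Hodge classes of the factors. [cite: Gordon1999HodgeAVSurvey, §9.2 (9.2.1)] -/
theorem sigmaLift_mem_ker_of_forall_mem_ker (Φ : ∀ i, Set (E i)) (a : ∀ i, E i → ℚ)
    (ha : ∀ i, a i ∈ LinearMap.ker (Matrix.of fun (g : G) (x : E i) => antiVec (Φ i) g x).mulVecLin) :
    sigmaLift a ∈ LinearMap.ker (Matrix.of fun (g : G) (x : Σ i, E i) => antiVec (sigmaType Φ) g x).mulVecLin := by
  rw [LinearMap.mem_ker, Matrix.mulVecLin_apply]
  funext g
  have hg : ∀ i, ((Matrix.of fun (g : G) (x : E i) => antiVec (Φ i) g x).mulVec (a i)) g = 0 := fun i => by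
    have := ha i
    rw [LinearMap.mem_ker, Matrix.mulVecLin_apply] at this
    exact congrFun this g
  simp only [Matrix.mulVec, dotProduct, Matrix.of_apply, antiVec_sigmaType, sigmaLift_apply] at hg ⊢
  rw [Pi.zero_apply, Fintype.sum_sigma]
  exact Finset.sum_eq_zero fun i _ => hg i

variable [∀ i, Nonempty (E i)] [Nonempty I]

/-- **THE DICTIONARY: `dim B(Σ) + rank(Σ) + |I| = Σ_i dim B(Φ_i) + Σ_i rank Φ_i + 1`**, i.e.
**`Σ_i dim Hg(A_i) − dim Hg(∏_i A_i) = dim B(Σ) − Σ_i dim B(Φ_i)`** — the defect of the family is the number of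
independent Galois-balanced weights on `⊔_i E_i` (supports of Hodge classes on the products of powers `∏_i A_i^{k_i}`)
MODULO the blockwise-balanced ones (supports of exterior products of Hodge classes of the factors).
[cite: Gordon1999HodgeAVSurvey, §9.2–9.3 and 7.5–7.7] [cite: Deligne1982HodgeCycles, I.5 (p. 62)] -/
theorem finrank_ker_sigmaType_add_typeRank_add_card_eq {ρ : G} {Φ : ∀ i, Set (E i)}
    (h : ∀ i, IsCMTypeWith ρ (Φ i)) :
    Module.finrank ℚ (LinearMap.ker
        (Matrix.of fun (g : G) (x : Σ i, E i) => antiVec (sigmaType Φ) g x).mulVecLin) +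
        typeRank G (sigmaType Φ) + Fintype.card I =
      (∑ i, Module.finrank ℚ (LinearMap.ker (Matrix.of fun (g : G) (x : E i) => antiVec (Φ i) g x).mulVecLin)) +
        (∑ i, typeRank G (Φ i)) + 1 := by
  obtain ⟨i₀⟩ := ‹Nonempty I›
  haveI : Nonempty (Σ i, E i) := ⟨⟨i₀, Classical.arbitrary (E i₀)⟩⟩
  have hS := finrank_ker_add_typeRank_eq_card_add_one (G := G) (IsCMTypeWith.sigmaType h)
  have hi : ∀ i, Module.finrank ℚ (LinearMap.ker (Matrix.of fun (g : G) (x : E i) => antiVec (Φ i) g x).mulVecLin) +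
      typeRank G (Φ i) = Fintype.card (E i) + 1 := fun i => finrank_ker_add_typeRank_eq_card_add_one (G := G) (h i)
  have hsum : (∑ i, Module.finrank ℚ (LinearMap.ker
      (Matrix.of fun (g : G) (x : E i) => antiVec (Φ i) g x).mulVecLin)) + ∑ i, typeRank G (Φ i) =
      (∑ i, Fintype.card (E i)) + Fintype.card I := by
    rw [← Finset.sum_add_distrib, Finset.sum_congr rfl fun i _ => hi i, Finset.sum_add_distrib, Finset.sum_const,
      Finset.card_univ, smul_eq_mul, mul_one]
  rw [Fintype.card_sigma] at hS
  omega

/-- **Equivalently `dim B(Σ) + dim Σ_i MC_i = Σ_i dim B(Φ_i) + Σ_i dim MC_i`** — the balanced weights of the product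
exceed the blockwise ones by exactly the dimension of the space of relations among the matrix-coefficient spaces
(gen 64 R1's defect). [cite: Gordon1999HodgeAVSurvey, §9.2–9.3] [cite: Deligne1982HodgeCycles, I.5 (p. 62)] -/
theorem finrank_ker_sigmaType_add_finrank_iSup_eq {ρ : G} {Φ : ∀ i, Set (E i)} (h : ∀ i, IsCMTypeWith ρ (Φ i)) :
    Module.finrank ℚ (LinearMap.ker
        (Matrix.of fun (g : G) (x : Σ i, E i) => antiVec (sigmaType Φ) g x).mulVecLin) +
        Module.finrank ℚ (⨆ i, Submodule.span ℚ (Set.range fun x : E i => fun g : G => antiVec (Φ i) g x) :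
          Submodule ℚ (G → ℚ)) =
      (∑ i, Module.finrank ℚ (LinearMap.ker (Matrix.of fun (g : G) (x : E i) => antiVec (Φ i) g x).mulVecLin)) +
        ∑ i, Module.finrank ℚ (Submodule.span ℚ (Set.range fun x : E i => fun g : G => antiVec (Φ i) g x)) := by
  have h1 := finrank_ker_sigmaType_add_typeRank_add_card_eq h
  have h2 := typeRank_sigmaType_add_card_add_sum_finrank_eq h
  omega

/-- **PAIRS: `dim B(Φ₀, Φ₁) = dim B(Φ₀) + dim B(Φ₁) + dim(MC₀ ∩ MC₁)`** — the glued-balanced weights of `A₀ × A₁` (and its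
powers) exceed the blockwise-balanced ones by the dimension of the common matrix coefficients, gen 64 R1's pair defect
`dim Hg(A₀) + dim Hg(A₁) − dim Hg(A₀ × A₁)`. [cite: Gordon1999HodgeAVSurvey, §9.2–9.3 and 7.5–7.7] -/
theorem finrank_ker_sigmaType_eq_add_add_finrank_inf_of_pair {ρ : G} {Φ : ∀ i, Set (E i)}
    (h : ∀ i, IsCMTypeWith ρ (Φ i)) {i₀ i₁ : I} (hI : ∀ j, j = i₀ ∨ j = i₁) (h01 : i₀ ≠ i₁) :
    Module.finrank ℚ (LinearMap.ker
        (Matrix.of fun (g : G) (x : Σ i, E i) => antiVec (sigmaType Φ) g x).mulVecLin) =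
      Module.finrank ℚ (LinearMap.ker (Matrix.of fun (g : G) (x : E i₀) => antiVec (Φ i₀) g x).mulVecLin) +
        Module.finrank ℚ (LinearMap.ker (Matrix.of fun (g : G) (x : E i₁) => antiVec (Φ i₁) g x).mulVecLin) +
        Module.finrank ℚ (Submodule.span ℚ (Set.range fun x : E i₀ => fun g : G => antiVec (Φ i₀) g x) ⊓
          Submodule.span ℚ (Set.range fun x : E i₁ => fun g : G => antiVec (Φ i₁) g x) : Submodule ℚ (G → ℚ)) := by
  have h1 := finrank_ker_sigmaType_add_typeRank_add_card_eq h
  have h2 := typeRank_add_typeRank_eq_of_pair h hI h01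
  have hcard : Fintype.card I = 2 := by
    rw [← Finset.card_univ, show (Finset.univ : Finset I) = {i₀, i₁} from Finset.ext fun j => by
      simpa only [Finset.mem_univ, Finset.mem_insert, Finset.mem_singleton, true_iff] using hI j,
      Finset.card_pair h01]
  rw [sum_eq_add_of_pair _ hI h01, sum_eq_add_of_pair _ hI h01, hcard] at h1
  omega

/-- **PAIRS, CANONICAL PIVOT: `dim B(Φ₀, Φ₁) = dim B(Φ₀) + dim B(Φ₁) + dim(F₀^{PW₁} ∩ F₁^{PW₀})`** — the number of
independent non-blockwise balanced weights of the pair is the dimension of the common orbit sums of C1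
`IrreducibleOddWeightsCanonicalPivot` (no hypothesis). [cite: Gordon1999HodgeAVSurvey, §9.2–9.3 and 7.5–7.7] -/
theorem finrank_ker_sigmaType_eq_add_add_finrank_stabOrbitSum_inf {ρ : G} {Φ : ∀ i, Set (E i)}
    (h : ∀ i, IsCMTypeWith ρ (Φ i)) {i₀ i₁ : I} (hI : ∀ j, j = i₀ ∨ j = i₁) (h01 : i₀ ≠ i₁) :
    Module.finrank ℚ (LinearMap.ker
        (Matrix.of fun (g : G) (x : Σ i, E i) => antiVec (sigmaType Φ) g x).mulVecLin) =
      Module.finrank ℚ (LinearMap.ker (Matrix.of fun (g : G) (x : E i₀) => antiVec (Φ i₀) g x).mulVecLin) +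
        Module.finrank ℚ (LinearMap.ker (Matrix.of fun (g : G) (x : E i₁) => antiVec (Φ i₁) g x).mulVecLin) +
        Module.finrank ℚ (Submodule.span ℚ (Set.range fun x₀ : E i₀ => fun g : G =>
            ∑ x ∈ Finset.univ.filter (fun x : E i₀ => ∃ n : G, (∀ y : E i₁, n • y = y) ∧ n • x₀ = x),
              antiVec (Φ i₀) g x) ⊓
          Submodule.span ℚ (Set.range fun x₁ : E i₁ => fun g : G =>
            ∑ x ∈ Finset.univ.filter (fun x : E i₁ => ∃ n : G, (∀ y : E i₀, n • y = y) ∧ n • x₁ = x),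
              antiVec (Φ i₁) g x) : Submodule ℚ (G → ℚ)) := by
  rw [finrank_ker_sigmaType_eq_add_add_finrank_inf_of_pair h hI h01, span_coeff_inf_eq_span_stabOrbitSum_inf Φ i₀ i₁]

end Family

end IrrOdd

/-! ### §3 CM fields: Pohlmann's balanced weights on `⊔_i Hom(K_i, ℂ)` -/

section CM

open NumberField
open Literature.NumberTheory.ComplexMultiplication
open Literature.AlgebraicGeometry.Motives (CMType)
open Literature.AlgebraicGeometry.Pohlmann1968

variable {I : Type} [Fintype I] {K : I → Type} [∀ i, Field (K i)] [∀ i, NumberField (K i)] [∀ i, IsCMField (K i)]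

omit [Fintype I] in
/-- **`dim B(Φ) + cmTypeRank Φ = [K:ℚ] + 1`** for a CM type `Φ` of a CM field `K` (`B(Φ)` = the rational weights on
`Hom(K, ℂ)` satisfying Pohlmann's condition; `dim B(Φ) = [K:ℚ] − dim Hg(A_Φ)`).
[cite: Gordon1999HodgeAVSurvey, §9.2–9.3] [cite: Deligne1982HodgeCycles, I Ex. 3.7 (c)] -/
theorem finrank_ker_add_cmTypeRank_eq {i : I} (Φ : CMType (K i)) :
    Module.finrank ℚ (LinearMap.ker
        (Matrix.of fun (g : ℂ ≃+* ℂ) (x : K i →+* ℂ) => antiVec Φ.1 g x).mulVecLin) + cmTypeRank Φ =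
      Module.finrank ℚ (K i) + 1 := by
  rw [← Embeddings.card (K i) ℂ]
  exact IrrOdd.finrank_ker_add_typeRank_eq_card_add_one (G := ℂ ≃+* ℂ) (isCMTypeWith_conj Φ)

/-- **THE DICTIONARY FOR CM FIELDS: `dim B(Σ) + cmFamilyRank Φ + |I| = Σ_i dim B(Φ_i) + Σ_i cmTypeRank Φ_i + 1`**, i.e.
**`Σ_i dim Hg(A_i) − dim Hg(∏_i A_i) = dim B(Σ) − Σ_i dim B(Φ_i)`** for every finite family of CM fields and types —
the codimension of `Hg(∏_i A_i)` in `∏_i Hg(A_i)` is the number of independent Galois-balanced rational weights on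
`⊔_i Hom(K_i, ℂ)` (supports of Hodge classes on the `∏_i A_i^{k_i}`, Pohlmann) beyond the blockwise-balanced ones
(exterior products of Hodge classes of the factors). [cite: Gordon1999HodgeAVSurvey, §9.2–9.3 and 7.5–7.7]
[cite: Deligne1982HodgeCycles, I.5 (p. 62)] -/
theorem finrank_ker_familyType_add_cmFamilyRank_add_card_eq [Nonempty I] (Φ : ∀ i, CMType (K i)) :
    Module.finrank ℚ (LinearMap.ker (Matrix.of fun (g : ℂ ≃+* ℂ) (x : (i : I) × (K i →+* ℂ)) =>
        antiVec (CMAlgebra.familyType Φ) g x).mulVecLin) + CMAlgebra.cmFamilyRank Φ + Fintype.card I =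
      (∑ i, Module.finrank ℚ (LinearMap.ker
        (Matrix.of fun (g : ℂ ≃+* ℂ) (x : K i →+* ℂ) => antiVec (Φ i).1 g x).mulVecLin)) +
        (∑ i, cmTypeRank (Φ i)) + 1 := by
  haveI : ∀ i, Nonempty (K i →+* ℂ) := fun i => inferInstance
  exact IrrOdd.finrank_ker_sigmaType_add_typeRank_add_card_eq (G := ℂ ≃+* ℂ) (E := fun i => K i →+* ℂ)
    (Φ := fun i => (Φ i).1) (fun i => isCMTypeWith_conj (Φ i))

omit [∀ i, IsCMField (K i)] in
/-- Membership in `B(Σ)` is Pohlmann's condition for the family type `Σ` of the CM algebra `∏_i K_i` (whose `ℕ`-valued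
solutions index the Hodge classes of the products of powers, tree `isNondegenerateFamily_iff_forall_nat_symm`).
[cite: Gordon1999HodgeAVSurvey, §9.2 (9.2.1)] -/
theorem mem_ker_familyType_iff_isBalanced (Φ : ∀ i, CMType (K i)) (a : ((i : I) × (K i →+* ℂ)) → ℚ) :
    a ∈ LinearMap.ker (Matrix.of fun (g : ℂ ≃+* ℂ) (x : (i : I) × (K i →+* ℂ)) =>
        antiVec (CMAlgebra.familyType Φ) g x).mulVecLin ↔
      IsBalanced (ℂ ≃+* ℂ) (CMAlgebra.familyType Φ) a :=
  IrrOdd.mem_ker_mulVecLin_antiVec_iff_isBalanced (G := ℂ ≃+* ℂ) _ a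

/-- **PAIRS OF CM FIELDS: `dim B(Φ₀, Φ₁) = dim B(Φ₀) + dim B(Φ₁) + dim(F₀ ∩ F₁)`** with the trace classes of C2
`IrreducibleOddWeightsCanonicalPivotCMFields` — the number of independent non-blockwise Galois-balanced weights on
`Hom(K₀, ℂ) ⊔ Hom(K₁, ℂ)` is the common dimension of the two orbit-sum spaces; no hypothesis.
[cite: Gordon1999HodgeAVSurvey, §9.2–9.3 and 7.5–7.7] -/
theorem finrank_ker_familyType_eq_add_add_finrank_stabOrbitSum_inf {i₀ i₁ : I} (h01 : i₀ ≠ i₁)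
    (hI : ∀ l, l = i₀ ∨ l = i₁) (Φ : ∀ i, CMType (K i)) :
    Module.finrank ℚ (LinearMap.ker (Matrix.of fun (g : ℂ ≃+* ℂ) (x : (i : I) × (K i →+* ℂ)) =>
        antiVec (CMAlgebra.familyType Φ) g x).mulVecLin) =
      Module.finrank ℚ (LinearMap.ker
          (Matrix.of fun (g : ℂ ≃+* ℂ) (x : K i₀ →+* ℂ) => antiVec (Φ i₀).1 g x).mulVecLin) +
        Module.finrank ℚ (LinearMap.ker
          (Matrix.of fun (g : ℂ ≃+* ℂ) (x : K i₁ →+* ℂ) => antiVec (Φ i₁).1 g x).mulVecLin) +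
        Module.finrank ℚ (Submodule.span ℚ (Set.range fun a : K i₀ →+* ℂ => fun g : ℂ ≃+* ℂ =>
            ∑ t ∈ Finset.univ.filter
              (fun t : K i₀ →+* ℂ => ∃ n : ℂ ≃+* ℂ, (∀ y : K i₁ →+* ℂ, n • y = y) ∧ n • a = t),
                antiVec (Φ i₀).1 g t) ⊓
          Submodule.span ℚ (Set.range fun a : K i₁ →+* ℂ => fun g : ℂ ≃+* ℂ =>
            ∑ t ∈ Finset.univ.filter
              (fun t : K i₁ →+* ℂ => ∃ n : ℂ ≃+* ℂ, (∀ y : K i₀ →+* ℂ, n • y = y) ∧ n • a = t),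
                antiVec (Φ i₁).1 g t) : Submodule ℚ ((ℂ ≃+* ℂ) → ℚ)) := by
  haveI : ∀ i, Nonempty (K i →+* ℂ) := fun i => inferInstance
  haveI : Nonempty I := ⟨i₀⟩
  exact IrrOdd.finrank_ker_sigmaType_eq_add_add_finrank_stabOrbitSum_inf (G := ℂ ≃+* ℂ) (E := fun i => K i →+* ℂ)
    (Φ := fun i => (Φ i).1) (fun i => isCMTypeWith_conj (Φ i)) hI h01

end CM

end Summit.HodgeConjecture.CorCM

end
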